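import Summits.BirchSwinnertonDyer.BirchSwinnertonDyer.Theorems.ClassRecordThreeEulerHalvesAtThreeWalkSupplyRootTransverse
import Summits.BirchSwinnertonDyer.BirchSwinnertonDyer.Theorems.ClassRecordThreeEulerHalvesAtThreeWalkTildeSign
import HarnessLib

/-!
# Cruxes `JetchevIrreducibleReadingByName` (20165) / `WildJetchevBoundAtP` (19941), registered stub S3′
# `stub_coreVertexExistenceIrredP` — step 3 of the irreducible port of bsd-jet's K5 strike: the ROOT-CLASS supplies of the
# walk (`ι_* c_k(Q) = c_{k+u}(P_s)`, Kummer and transverse places of the root class, its sign) in IMAGE-AGNOSTIC form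

Cell `bsd-potss`, seat `bsd-potss-k9-c4` g10; `--supports stmt-BirchSwinnertonDyer-20165`, helper; route-free; theorems only;
nothing booked, no item closed, BSD is not proved by any of this.

WHAT. The kernel walk behind Jetchev's Prop. 5.3 (`JET.jetchevCoreVertexExistence_lt_of_namedPrint`, bsd-jet pv-1 g8) builds the
class `κ̃_s` of a `p^u`-th root `Q` of the derived point `P_s` ([J] §3.1 item 7) from FOUR supplies of cell bsd-stepL (seat
tam3-p1): `Walk.torsionH1OfDvd_rootClass` / `Walk.localization_rootClass_mem_kummer` (`…WalkSupplySelmer`),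
`Walk.localization_rootClass_mem_globalTransverse` (`…WalkSupplyRootTransverse`) and `Koly.conjAct_kolyvaginClass_root_eq_sign_smul_zhang`
(`…WalkTildeSign`). Each uses the frame binder `ρ̄_{E,p}` onto in EXACTLY ONE place: the admissibility of `A = E(K[s]) ⊆ E(K̄)`
for `p^{k+u}` (no `K[s]`-rational `p`-torsion, `RingClassNoTorsion.isAdmissible_pointsSubgroup`). THIS FILE re-issues the four
with that admissibility as an explicit HYPOTHESIS `hA` (statements and proofs otherwise byte-identical): `…_of_admissible`. On
the irreducible rows of S3′ (`E[p]` irreducible, `p ∣ N_E`, Heegner field) `hA` is x11b3's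
`NoTorsionIrr.isAdmissible_pointsSubgroup_of_hasIrreducibleModPGaloisRep[_of_dvd]` (Gross Lemma 4.3 on the irreducible cell) /
k8t-c4's `JetchevIrreducibleReadingThm52.isAdmissible_of_irreducible_of_dvd_conductorNorm`; on the surjective rows it is tam3-p1's
original input — so both cells can consume these.
References (locators only): [cite: Jetchev2008, §3.1 items 6–7 (p. 817), §3.1.2, Prop. 4.5–4.6] [cite: McCallumLMS1991, §4 Lemma 4.1,
Lemma 4.3, (6), Lemma 4.6] [cite: GrossLMS1991, §4 (4.4), (4.6), Lemma 4.3, Prop. 5.3, Prop. 5.4 (1)–(2), Prop. 9.6]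
[cite: Howard2004HeegnerKolyvagin, Lemma 2.7.3]. Design: theorems only; `K : Type`.
presearch (D-0021): `lean search 'rootClass'` → tam3-p1's surjective supplies and corner-p1's level-one avatars only. Kernel
plumbing; corpus not needed.
-/

set_option autoImplicit false
-- the Theorems directory repeats the summit name (sibling precedent `KatoDescentPotSupersingularAssembly.lean`)
set_option linter.dupNamespace false

noncomputable section

open scoped Classical Pointwise NumberField
open Function NumberField IsDedekindDomain WeierstrassCurve Field
open Literature.NumberTheory.EllipticCurves Literature.NumberTheory.GaloisRepresentations
open Literature.NumberTheory.EllipticCurves.Jetchev2008 Literature.NumberTheory.EllipticCurves.KolyvaginCocycle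
open Literature.NumberTheory.EllipticCurves.ModularForms
open Literature.NumberTheory.GaloisCohomology Literature.NumberTheory.Automorphic
open Literature.NumberTheory.GaloisRepresentations.DiscreteGaloisModule (transverseSubgroup SelmerStructure)
open Summit.BirchSwinnertonDyer.Rank1Residual.JET.SelmerVocabulary
open Summit.BirchSwinnertonDyer.Rank1Residual.JET.GlobalDuality
open Summit.BirchSwinnertonDyer.Rank1Residual Summit.BirchSwinnertonDyer.Rank1Residual.X11b
open Summit.BirchSwinnertonDyer.Rank1Residual.X11b.Three
open Summit.BirchSwinnertonDyer.Rank1Residual.JET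
open Summit.BirchSwinnertonDyer.BirchSwinnertonDyer.Theorems

namespace Summit.BirchSwinnertonDyer.BirchSwinnertonDyer.Theorems.JetchevIrreducibleCoreVertex

section RootClass

variable {K : Type} [Field K] [NumberField K] (W : WeierstrassCurve ℚ) [W.IsElliptic]
  [W.IsGloballyMinimal] [NeZero (W.conductorNorm ℤ)]

variable {Dt : ModularParametrizationData W (W.conductorNorm ℤ)} {β : ℤ} {ι : K →+* ℂ}

/-! ### The change of level: `ι_* c_k(Q) = c_{k+u}(P_s)` -/

omit [W.IsElliptic] [W.IsGloballyMinimal] in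
/-- **`ι_* c_k(Q) = c_{k+u}(P_s)` for a `p^u`-th root `Q ∈ E(K[s])` of the derived point** (the same
McCallum cocycle; corner-p1's `torsionH1OfDvd_kolyvaginClass_of_zsmul` on the Kolyvagin–Heegner datum,
with the admissibility of `E(K[s]) ⊆ E(K̄)` for `p^{k+u}` an explicit HYPOTHESIS `hA` — image-agnostic form of
tam3-p1's `Walk.torsionH1OfDvd_rootClass`, which supplies it from `ρ̄_{E,p}` onto; on the irreducible rows it comes from
`NoTorsionIrr` / k8t-c4's `isAdmissible_of_irreducible_of_dvd_conductorNorm`).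
[cite: McCallumLMS1991, §4 Lemma 4.1, (6), Lemma 4.6] [cite: GrossLMS1991, §4 (4.4), (4.6)] -/
theorem torsionH1OfDvd_rootClass_of_admissible {p : ℕ} (hp : p.Prime)
    {s : ℕ} (d : KolyvaginHeegnerData Dt β ι s)
    (k u : ℕ) (hA : IsAdmissible (absoluteGaloisGroup K) d.pointsSubgroup ((p ^ (k + u) : ℕ) : ℤ)) (Q : (W.baseChange (ringClassField K ι s)).toAffine.Point)
    (hAk : IsAdmissible (absoluteGaloisGroup K) d.pointsSubgroup ((p ^ k : ℕ) : ℤ))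
    (hQ : d.toGeomPoints Q ∈ invPoints (absoluteGaloisGroup K) d.pointsSubgroup ((p ^ k : ℕ) : ℤ))
    (hQP : ((p ^ u : ℕ) : ℤ) • Q = d.derivedPoint)
    (hP : d.toGeomPoints d.derivedPoint ∈
      invPoints (absoluteGaloisGroup K) d.pointsSubgroup ((p ^ (k + u) : ℕ) : ℤ)) :
    WeierstrassCurve.torsionH1OfDvd (W.baseChange K)
        (show ((p ^ k : ℕ) : ℤ) ∣ ((p ^ (k + u) : ℕ) : ℤ) by
          exact_mod_cast pow_dvd_pow p (Nat.le_add_right k u))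
        (kolyvaginClass (W.baseChange K) ((p ^ k : ℕ) : ℤ)
          ((W.baseChange K).zsmul_geomPoints_surjective_of_charZero
            (by exact_mod_cast pow_ne_zero k hp.ne_zero)) hAk (d.toGeomPoints Q) hQ) =
      d.kolyvaginClass hp (k + u) := by
  rw [d.kolyvaginClass_of_admissible hp (k + u) hA hP]
  refine X11b.Three.Koly.torsionH1OfDvd_kolyvaginClass_of_zsmul
    (W.baseChange K) _ (m := ((p ^ u : ℕ) : ℤ)) ?_ _ _ hAk hA hQ ?_ hP
  · push_cast; ring
  · rw [← map_zsmul, hQP]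

/-! ### Kummer places of the root class -/

omit [W.IsElliptic] [W.IsGloballyMinimal] in
/-- **The root class `c_k(Q)` is KUMMER wherever `c_{k+u}(P_s)` is**: the local Kummer kernel is
cartesian under the change of level `ι_*` (`mem_selmerLocalKer_iff_torsionH1OfDvd_mem`) and
`ι_* c_k(Q) = c_{k+u}(P_s)` — image-agnostic form (admissibility for `p^{k+u}` a hypothesis `hA`) of tam3-p1's
`Walk.localization_rootClass_mem_kummer`. [cite: McCallumLMS1991, §4 Lemma 4.3, Lemma 4.6]
[cite: SilvermanAEC2009, X.§4 (Remark 4.1.1)] -/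
theorem localization_rootClass_mem_kummer_of_admissible {p : ℕ} (hp : p.Prime) {s : ℕ}
    (d : KolyvaginHeegnerData Dt β ι s) (k u : ℕ)
    (hA : IsAdmissible (absoluteGaloisGroup K) d.pointsSubgroup ((p ^ (k + u) : ℕ) : ℤ)) (Q : (W.baseChange (ringClassField K ι s)).toAffine.Point)
    (hAk : IsAdmissible (absoluteGaloisGroup K) d.pointsSubgroup ((p ^ k : ℕ) : ℤ))
    (hQ : d.toGeomPoints Q ∈ invPoints (absoluteGaloisGroup K) d.pointsSubgroup ((p ^ k : ℕ) : ℤ))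
    (hQP : ((p ^ u : ℕ) : ℤ) • Q = d.derivedPoint)
    (hP : d.toGeomPoints d.derivedPoint ∈
      invPoints (absoluteGaloisGroup K) d.pointsSubgroup ((p ^ (k + u) : ℕ) : ℤ))
    (v : Place K)
    (hv : galoisCohomology.localization ((W.baseChange K).torsionGaloisModule ((p ^ (k + u) : ℕ) : ℤ)) v 1
        (d.kolyvaginClass hp (k + u)) ∈
      (W.baseChange K).kummerSelmerStructure ((p ^ (k + u) : ℕ) : ℤ) v) :
    galoisCohomology.localization ((W.baseChange K).torsionGaloisModule ((p ^ k : ℕ) : ℤ)) v 1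
        (kolyvaginClass (W.baseChange K) ((p ^ k : ℕ) : ℤ)
          ((W.baseChange K).zsmul_geomPoints_surjective_of_charZero
            (by exact_mod_cast pow_ne_zero k hp.ne_zero)) hAk (d.toGeomPoints Q) hQ) ∈
      (W.baseChange K).kummerSelmerStructure ((p ^ k : ℕ) : ℤ) v := by
  have hdn : ((p ^ k : ℕ) : ℤ) ∣ ((p ^ (k + u) : ℕ) : ℤ) := by
    exact_mod_cast pow_dvd_pow p (Nat.le_add_right k u)
  have key : WeierstrassCurve.torsionH1OfDvd (W.baseChange K) hdn
      (kolyvaginClass (W.baseChange K) ((p ^ k : ℕ) : ℤ)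
        ((W.baseChange K).zsmul_geomPoints_surjective_of_charZero
          (by exact_mod_cast pow_ne_zero k hp.ne_zero)) hAk (d.toGeomPoints Q) hQ) ∈
      selmerLocalKer (W.baseChange K) (Place.Completion v) ((p ^ (k + u) : ℕ) : ℤ) := by
    rw [torsionH1OfDvd_rootClass_of_admissible W hp d k u hA Q hAk hQ hQP hP,
      ← (W.baseChange K).comap_localization_kummerSelmerStructure]
    exact hv
  rw [← AddSubgroup.mem_comap, (W.baseChange K).comap_localization_kummerSelmerStructure]
  exact (Summit.BirchSwinnertonDyer.BirchSwinnertonDyer.Theorems.mem_selmerLocalKer_iff_torsionH1OfDvd_mem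
    (W.baseChange K) (Place.Completion v) hdn _).mpr key


/-! ### Transverse places of the root class -/

variable {p : ℕ} [Fact p.Prime] {k : ℕ} [∀ j : ℕ, NumberField (ringClassField K ι j)]
  {𝒯 : SelmerStructure ((W.baseChange K).torsionGaloisModule ((p ^ k : ℕ) : ℤ))}
  (h𝒯 : ∀ v : HeightOneSpectrum (𝓞 K), 𝒯 (Sum.inr v) =
    ⨅ (ℓ : ℕ) (_ : ℓ.Prime ∧ (ℓ : 𝓞 K) ∈ v.asIdeal),
      ⨅ (w' : HeightOneSpectrum (𝓞 (ringClassField K ι ℓ)))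
        (_ : w'.asIdeal.LiesOver v.asIdeal),
        letI := (adicCompletionOfLiesOver K (ringClassField K ι ℓ) v w').toAlgebra
        transverseSubgroup (GaloisRep.toLocal v ((W.baseChange K).torsionGaloisModule ((p ^ k : ℕ) : ℤ)))
          (w'.adicCompletion (ringClassField K ι ℓ)))

include h𝒯 in
/-- **The ROOT class is transverse at the primes of `s` (for the level-`k` global intrinsic family) as
soon as `c_{k+u}(P_s)` lies in `transverseKer_{k+u} ℓ` for every `ℓ ∣ s`** — the reduction of the root
form of the gap `htr` to bsd-jet's form one level up (`ι_* c_k(Q) = c_{k+u}(P_s)`; cartesian transverse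
condition at the places over the primes of `s`, whose local Galois groups fix `E[p^{k+u}]`) — image-agnostic form
(admissibility for `p^{k+u}` a hypothesis `hA`) of tam3-p1's `Walk.localization_rootClass_mem_globalTransverse`.
[cite: Jetchev2008, §3.1 item 7, §3.1.2] [cite: McCallumLMS1991, §4 Lemma 4.6] [cite: GrossLMS1991, Prop. 9.6] -/
theorem localization_rootClass_mem_globalTransverse_of_admissible (hK : IsImaginaryQuadratic K)
    {s : ℕ} (hs : Squarefree s) {u : ℕ}
    (hsK : ∀ ℓ ∈ s.primeFactors, Zhang2014.IsKolyvaginPrime (W.conductorNorm ℤ) W K p ℓ ∧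
      k + u ≤ Zhang2014.kolyvaginIndex W p ℓ)
    (d : KolyvaginHeegnerData Dt β ι s)
    (hA : IsAdmissible (absoluteGaloisGroup K) d.pointsSubgroup ((p ^ (k + u) : ℕ) : ℤ))
    (Q : (W.baseChange (ringClassField K ι s)).toAffine.Point)
    (hAk : IsAdmissible (absoluteGaloisGroup K) d.pointsSubgroup ((p ^ k : ℕ) : ℤ))
    (hQ : d.toGeomPoints Q ∈ invPoints (absoluteGaloisGroup K) d.pointsSubgroup ((p ^ k : ℕ) : ℤ))
    (hQP : ((p ^ u : ℕ) : ℤ) • Q = d.derivedPoint)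
    (hP : d.toGeomPoints d.derivedPoint ∈
      invPoints (absoluteGaloisGroup K) d.pointsSubgroup ((p ^ (k + u) : ℕ) : ℤ))
    (htr : ∀ ℓ ∈ s.primeFactors,
      (d.kolyvaginClass (Fact.out : p.Prime) (k + u) :
        galoisCohomology ((W.baseChange K).torsionGaloisModule ((p ^ (k + u) : ℕ) : ℤ)) 1) ∈
        transverseKer W K ι ((p ^ (k + u) : ℕ) : ℤ) ℓ) :
    ∀ v ∈ placesDividing K s,
      galoisCohomology.localization ((W.baseChange K).torsionGaloisModule ((p ^ k : ℕ) : ℤ)) (Sum.inr v) 1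
          (kolyvaginClass (W.baseChange K) ((p ^ k : ℕ) : ℤ)
            ((W.baseChange K).zsmul_geomPoints_surjective_of_charZero
              (by exact_mod_cast pow_ne_zero k (Fact.out : p.Prime).ne_zero)) hAk (d.toGeomPoints Q) hQ) ∈
        𝒯 (Sum.inr v) := by
  have hp : p.Prime := Fact.out
  have hs0 : s ≠ 0 := hs.ne_zero
  -- the global intrinsic family one level up and the transverse membership of `c_{k+u}(P_s)` there
  obtain ⟨𝒯', h𝒯', -⟩ := Walk.exists_globalTransverseFamily W ι ((p ^ (k + u) : ℕ) : ℤ)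
  have hup : ∀ v ∈ placesDividing K s,
      galoisCohomology.localization ((W.baseChange K).torsionGaloisModule ((p ^ (k + u) : ℕ) : ℤ))
          (Sum.inr v) 1 (d.kolyvaginClass hp (k + u)) ∈ 𝒯' (Sum.inr v) :=
    (Walk.globalTransverse_mem_iff h𝒯' hs _).mpr htr
  intro v hv
  -- `v` lies over a prime `ℓ₀ ∣ s`, Kolyvagin of index `≥ k + u`: `Γ_{K_v}` fixes `E[p^{k+u}]`
  obtain ⟨ℓ₀, hℓ₀, hℓ₀v⟩ := (natCast_mem_iff_exists_primeFactor_mem hs0 v).mp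
    ((mem_placesDividing_iff_natCast_mem hs0 v).mp hv)
  have htriv : ∀ (g : absoluteGaloisGroup (v.adicCompletion K))
      (P : geomTorsion (W.baseChange K) ((p ^ (k + u) : ℕ) : ℤ)), resGal (K := K) (v.adicCompletion K) g • P = P :=
    Walk.resGal_adicCompletion_smul_torsion_eq_self W hK (hsK ℓ₀ hℓ₀).1 (hsK ℓ₀ hℓ₀).2 v hℓ₀v
  -- the cartesian property of the transverse condition under `ι_*` (corner-p1)
  have hdn : p ^ k ∣ p ^ (k + u) := pow_dvd_pow p (Nat.le_add_right k u)
  refine (localization_torsionH1OfDvd_mem_globalTransverse_iff W hdn h𝒯 h𝒯' v htriv _).mpr ?_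
  rw [torsionH1OfDvd_rootClass_of_admissible W hp d k u hA Q hAk hQ hQP hP]
  exact hup v hv


end RootClass

/-! ### The sign of the root class (Gross Prop. 5.4 (1) at the deeper level, Prop. 5.3 by name) -/

section Sign

variable {K : Type} [Field K] [NumberField K] {N : ℕ} [NeZero N] {W : WeierstrassCurve ℚ}
  {Dt : ModularParametrizationData W N} {β : ℤ} {ι : K →+* ℂ} {n : ℕ}

/-- **The sign of `κ̃` for the concrete data, supplied**: with the congruence of Gross Prop. 5.4 (1) at
level `p^{k+u}` from bsd-jet's `JET.pointsMap_derivedPoint_concrete_of_prop53_zhang` (data at the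
divisors of `n`, all prime factors Kolyvagin of index `≥ k + u`, `(N, d_K) = 1`, `d_K < −4`, modulo
Gross Prop. 5.3 `h53` at every divisor) and the `τ̃`-stability of `E(K[n])`
(`RingClassConj.pointsMap_mem_pointsSubgroup`): `c_* c(Q) = (ε·(−1)^{#primes of n}) • c(Q)` for every
`p^u`-th root `Q` of `P_n` with `[Q]` invariant mod `p^k`. [cite: GrossLMS1991, Prop. 5.3, Prop. 5.4]
[cite: Jetchev2008, §3.1 items 6–7 (p. 817)] -/
theorem conjAct_kolyvaginClass_root_eq_sign_smul_zhang_of_admissible [W.IsElliptic] [W.IsGloballyMinimal]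
    (hK : IsImaginaryQuadratic K) {p : ℕ} (hp : p.Prime)
    (hND : IsCoprime (N : ℤ) (NumberField.discr K)) (hD : NumberField.discr K < -4)
    {k u : ℕ} (hk : 1 ≤ k) (hn : Squarefree n)
    (hkol : ∀ q ∈ n.primeFactors,
      Zhang2014.IsKolyvaginPrime N W K p q ∧ k + u ≤ Zhang2014.kolyvaginIndex W p q)
    (data : (m : ℕ) → m ∣ n → KolyvaginHeegnerData Dt β ι m)
    (hA : ∀ (m : ℕ) (hm : m ∣ n),
      IsAdmissible (absoluteGaloisGroup K) (data m hm).pointsSubgroup ((p ^ (k + u) : ℕ) : ℤ))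
    {c : K ≃ₐ[ℚ] K} (hc : c ≠ 1) (ε : ℤ)
    (h53 : ∀ (m : ℕ) (hm : m ∣ n) (τm : ringClassField K ι m ≃ₐ[ℚ] ringClassField K ι m),
      (∀ x : ringClassField K ι m, ((τm x : ringClassField K ι m) : ℂ) = starRingEnd ℂ x) →
      ∃ σ' ∈ ringClassGal ι m, IsOfFinAddOrder
        (pointGalHom W (ringClassField K ι m) τm (data m hm).y -
          ε • pointGalHom W (ringClassField K ι m) σ' (data m hm).y))
    (Q : (W.baseChange (ringClassField K ι n)).toAffine.Point)
    (hQP : ((p ^ u : ℕ) : ℤ) • Q = (data n dvd_rfl).derivedPoint)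
    (hAk : IsAdmissible (absoluteGaloisGroup K) (data n dvd_rfl).pointsSubgroup ((p ^ k : ℕ) : ℤ))
    (hQ : (data n dvd_rfl).toGeomPoints Q ∈
      invPoints (absoluteGaloisGroup K) (data n dvd_rfl).pointsSubgroup ((p ^ k : ℕ) : ℤ)) :
    conjAct W c ((p ^ k : ℕ) : ℤ) (kolyvaginClass (W.baseChange K) ((p ^ k : ℕ) : ℤ)
        ((W.baseChange K).zsmul_geomPoints_surjective_of_charZero
          (by exact_mod_cast pow_ne_zero k hp.ne_zero)) hAk ((data n dvd_rfl).toGeomPoints Q) hQ) =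
      (ε * (-1) ^ n.primeFactors.card) • kolyvaginClass (W.baseChange K) ((p ^ k : ℕ) : ℤ)
        ((W.baseChange K).zsmul_geomPoints_surjective_of_charZero
          (by exact_mod_cast pow_ne_zero k hp.ne_zero)) hAk ((data n dvd_rfl).toGeomPoints Q) hQ := by
  have hτ : IsLiftOfAut c (liftAut c) := isLiftOfAut_liftAut c
  obtain ⟨B, hB, hcong⟩ := JET.pointsMap_derivedPoint_concrete_of_prop53_zhang hK ι hp
    (le_trans hk (Nat.le_add_right k u)) Dt hND hD hn hkol data hc hτ ε h53 hA n dvd_rfl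
  exact Koly.conjAct_kolyvaginClass_root_eq_smul (data n dvd_rfl) hp (hA n dvd_rfl) hτ
    (RingClassConj.pointsMap_mem_pointsSubgroup hK hn.ne_zero (data n dvd_rfl) hτ) _ ⟨B, hB, hcong⟩ Q
    hQP hAk hQ


end Sign

end Summit.BirchSwinnertonDyer.BirchSwinnertonDyer.Theorems.JetchevIrreducibleCoreVertex

end
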